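import Summits.BirchSwinnertonDyer.BirchSwinnertonDyer.Theorems.RamifiedSevenEllipticUnitsStrictTorsionOfGZK
import HarnessLib

set_option linter.dupNamespace false
set_option autoImplicit false

/-!
# Route `RamifiedSevenEllipticUnits` (rung K7r): the conditional twin of crux #3,
# `StrictTorsionSevenOfGZK` (stmt-BirchSwinnertonDyer-19677) — CLOSED by name

Cell `bsd-cm`, seat `bsd-cm-k7r-c3`. The twin is exactly the type of
`RamifiedSevenEllipticUnits.strictTorsionSeven_of_GZK` (p430232, k7r-c4 g2,
`Theorems/RamifiedSevenEllipticUnitsStrictTorsionOfGZK.lean`): in analytic rank one (R-tors)@7 follows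
from the finiteness of the two `ℚ`-side strict `7^∞`-Selmer groups of each frame (Greenberg's criterion
on the dual pair + exact control for 𝒞₇ + the finiteness-free twist-descent count), and that finiteness
is Gross–Zagier–Kolyvagin. Nothing new is asserted; BSD is not proved by any of this (a closed item
closes a rung leaf of BirchSwinnertonDyer at most, never the summit).
-/

namespace Summit.BirchSwinnertonDyer.BirchSwinnertonDyer.Theorems

/-- **`StrictTorsionSevenOfGZK` holds**: it is `RamifiedSevenEllipticUnits.strictTorsionSeven_of_GZK` (p430232) read at the
route item's fully-qualified type. [cite: Kolyvagin1990, Thm. A] [cite: GreenbergLNM1716, §1 p. 61 and §4 Lemma 4.2 (p. 102)] -/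
theorem strictTorsionSevenOfGZK_proof :
    Summit.BirchSwinnertonDyer.BirchSwinnertonDyer.Theses.RamifiedSevenEllipticUnits.StrictTorsionSevenOfGZK :=
  fun h => RamifiedSevenEllipticUnits.strictTorsionSeven_of_GZK h

end Summit.BirchSwinnertonDyer.BirchSwinnertonDyer.Theorems
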